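import Summits.ResolutionOfSingularities.ResolutionOfSingularities.Theorems.EquisingularLiftEquisingularLiftNatOneStepVertexChart
import HarnessLib

/-!
# [OURS] THE VERTEX CHART OF A TWO-STEP POINT, PRIME BY PRIME: at the primes of the chart ring `(A/(f))[Ī/ȳ_a]` over the exceptional divisor the
# localisation is REGULAR OR the prime is THE ORIGIN of the chart — the disjunctive form of ✓ `OneStep.isRegularLocalRing_localization_blowupAlgebra`
# consumed by second-order (level-1) data, with the chart presentation `K[T]/(G) ≅ (A/(f))[Ī/ȳ_a]` EXPOSED
# (cruxes `Theses.EquisingularLift.EquisingularLiftNat` / `…NatThree` / `EquisingularLift`, stmt-ResolutionOfSingularities-20038 / -20148 / -15660)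

[OURS · leafhand-res-equisingularlift-11 g0, 2026-08-31; cell `pub/decomp-res`] AI-produced, weaker than expert review; NOT a statement of any manuscript;
nothing here proves resolution of singularities in positive characteristic.  DEF-FREE helper; no `sorry`; standard axioms; ZERO named hypotheses.

✓ `OneStep.isRegularLocalRing_localization_blowupAlgebra` (p561125) turns the ONE-STEP datum «at every prime `P ∋ T_a, G` some `∂_jG ∉ P`» into
regularity of the chart ring `(A/(f))[Ī/ȳ_a]` (`A = K[y]`, `f = Φ + Ψ`, `I = (y)`) at every prime over the exceptional divisor.  The SECOND-ORDER data of
✓ …SecondOrderAPoints / …A3Recognition / …ALadder / …DLadder are disjunctive: «at every prime `P ∋ T_a, G` some `∂_jG ∉ P` OR `P ⊇ (T)`» (the strict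
transform is singular on `E` at most at the chart origin).  This file transports the disjunction, by the SAME isomorphisms (`θ : K[T] ≅ A[I/y_a]`,
`K[T]/(G) ≅ A[I/y_a]/(g₁) ≅ (A/(f))[Ī/ȳ_a]`, proof of p561125 verbatim up to its last step):

* ★★★ `OneStep.exists_chartEquiv_regular_or_eq_origin` — there is a ring isomorphism `χ : K[T]/(G) ≃ (A/(f))[Ī/ȳ_a]` with `χ(T̄_a) = ȳ_a` (the
  exceptional equation) such that, under the disjunctive datum, every prime `𝔑 ∋ ȳ_a` of the chart ring has REGULAR localisation OR EQUALS
  `χ((T̄))`, the image of the origin of `K[T]/(G)`.  Hence (scheme side, for a later hand): `Spec χ` identifies the chart of the blow-up with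
  `Spec K[T]/(G)`, the only possibly non-regular point of the chart over the exceptional divisor is the image of the origin, a CLOSED point, at which
  ✓ `OneStep.oneStepAt_origin` (…NatAffineOneStepOrigin) applies with the second-order (hone') data — bricks B2/B3 of the level-1 bridge.

Honest label: closes no registered stub.

References: [GortzWedhorn2020, Prop. 13.96]; [StacksProject, Tag 0BIQ]; [Matsumura1987, Thm. 14.2]; through the cited tree files.
-/

set_option linter.dupNamespace false -- mandated namespace `Summit.<Summit>.<Problem>` of this single-conjunct summit

noncomputable section

namespace Summit.ResolutionOfSingularities.ResolutionOfSingularities.Cruxes.EquisingularLiftNat.Sections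

open MvPolynomial IsLocalization IsLocalRing Literature.AlgebraicGeometry.Resolution

namespace OneStep

set_option maxHeartbeats 2400000 in -- the chart algebra `blowupAlgebra` is a subalgebra of a localisation: slow instance unification (as in …NatOneStepVertexChart, ×3: two goals share the isomorphisms)
/-- ★★★ **THE VERTEX CHART OF A TWO-STEP POINT, PRIME BY PRIME.**  `A = K[y₀,…,y_N]`, `I = (y)`, `f = Φ + Ψ` with `Φ ≠ 0` a form of degree `μ` and
`Ψ ∈ I^{μ+1}`; `G` with `f(T_a, T_aT_j) = T_a^μ·G`.  There is a ring isomorphism `χ : K[T]/(G) ≃+* (A/(f))[Ī/ȳ_a]` with `χ(T̄_a) = ȳ_a` such that: if at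
every prime `P ∋ T_a, G` of `K[T]` either some `∂G/∂T_j ∉ P` or all `T_i ∈ P`, then every prime `𝔑` of the chart ring containing `ȳ_a` has regular
localisation or equals `χ((T̄))` (the chart origin). [cite: GortzWedhorn2020, Prop. 13.96] [cite: Matsumura1987, Thm. 14.2] -/
theorem exists_chartEquiv_regular_or_eq_origin (K : Type) [Field K] {N : ℕ} (Φ Ψ : MvPolynomial (Fin (N + 1)) K) {μ : ℕ}
    (hΦ : Φ.IsHomogeneous μ) (hΦ0 : Φ ≠ 0)
    (hΨ : Ψ ∈ Ideal.span (Set.range (X : Fin (N + 1) → MvPolynomial (Fin (N + 1)) K)) ^ (μ + 1)) (a : Fin (N + 1))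
    (G : MvPolynomial (Fin (N + 1)) K)
    (hG : aeval (fun j => X a * Function.update (X : Fin (N + 1) → MvPolynomial (Fin (N + 1)) K) a 1 j) (Φ + Ψ) = X a ^ μ * G) :
    ∃ χ : (MvPolynomial (Fin (N + 1)) K ⧸ Ideal.span {G}) ≃+*
        blowupAlgebra ((Ideal.span (Set.range (X : Fin (N + 1) → MvPolynomial (Fin (N + 1)) K))).map
          (Ideal.Quotient.mk (Ideal.span {Φ + Ψ}))) (Ideal.Quotient.mk (Ideal.span {Φ + Ψ}) (X a)),
      χ (Ideal.Quotient.mk (Ideal.span {G}) (X a)) =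
        algebraMap (MvPolynomial (Fin (N + 1)) K ⧸ Ideal.span {Φ + Ψ}) _ (Ideal.Quotient.mk (Ideal.span {Φ + Ψ}) (X a)) ∧
      ((∀ P : Ideal (MvPolynomial (Fin (N + 1)) K), P.IsPrime → (X a : MvPolynomial (Fin (N + 1)) K) ∈ P → G ∈ P →
          (∃ j, pderiv j G ∉ P) ∨ ∀ i, (X i : MvPolynomial (Fin (N + 1)) K) ∈ P) →
        ∀ (𝔑 : Ideal (blowupAlgebra ((Ideal.span (Set.range (X : Fin (N + 1) → MvPolynomial (Fin (N + 1)) K))).map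
          (Ideal.Quotient.mk (Ideal.span {Φ + Ψ}))) (Ideal.Quotient.mk (Ideal.span {Φ + Ψ}) (X a)))) [𝔑.IsPrime],
          algebraMap (MvPolynomial (Fin (N + 1)) K ⧸ Ideal.span {Φ + Ψ}) _ (Ideal.Quotient.mk (Ideal.span {Φ + Ψ}) (X a)) ∈ 𝔑 →
          IsRegularLocalRing (Localization.AtPrime 𝔑) ∨
            𝔑 = Ideal.map χ.toRingHom (Ideal.map (Ideal.Quotient.mk (Ideal.span {G}))
              (Ideal.span (Set.range (X : Fin (N + 1) → MvPolynomial (Fin (N + 1)) K))))) := by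
  classical
  have hx : IsQuasiRegular (X : Fin (N + 1) → MvPolynomial (Fin (N + 1)) K) := ConeN.isQuasiRegular_X K (N := N)
  haveI hdom : IsDomain (MvPolynomial (Fin (N + 1)) K ⧸ Ideal.span (Set.range (X : Fin (N + 1) → MvPolynomial (Fin (N + 1)) K))) :=
    ConeN.isDomain_quotient_origin K (N := N)
  -- the core's presentation `f = t^μ · g₁`, `g₁ = Φ(e) + tψ`
  have hΦ'h : (MvPolynomial.map (C : K →+* MvPolynomial (Fin (N + 1)) K) Φ).IsHomogeneous μ := hΦ.map _
  have heval : MvPolynomial.eval (X : Fin (N + 1) → MvPolynomial (Fin (N + 1)) K) (MvPolynomial.map (C : K →+* MvPolynomial (Fin (N + 1)) K) Φ) = Φ := by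
    rw [MvPolynomial.eval_map]
    exact MvPolynomial.eval₂_eta Φ
  obtain ⟨ψ, hcore⟩ := exists_algebraMap_tangentCone_eq (X : Fin (N + 1) → MvPolynomial (Fin (N + 1)) K) a hΦ'h hΨ
  rw [heval] at hcore
  have hΦbar : MvPolynomial.map (Ideal.Quotient.mk (Ideal.span (Set.range (X : Fin (N + 1) → MvPolynomial (Fin (N + 1)) K))))
      (dehomogenize a (MvPolynomial.map (C : K →+* MvPolynomial (Fin (N + 1)) K) Φ)) ≠ 0 := by
    rw [← map_dehomogenize, MvPolynomial.map_map]
    haveI : Nontrivial (MvPolynomial (Fin (N + 1)) K ⧸ Ideal.span (Set.range (X : Fin (N + 1) → MvPolynomial (Fin (N + 1)) K))) :=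
      hdom.toNontrivial
    intro h0
    apply dehomogenize_ne_zero_of_isHomogeneous a hΦ hΦ0
    exact (MvPolynomial.map_injective _ (RingHom.injective _)) (h0.trans (map_zero _).symm)
  obtain ⟨ε, hε⟩ := exists_quotient_strictTransform_equiv_blowupAlgebra (X : Fin (N + 1) → MvPolynomial (Fin (N + 1)) K) a hx
    hΦbar ψ hcore
  -- `θ : K[T] ≅ A[I/y_a]` takes `G` to `g₁`
  obtain ⟨θ, hθa, hθj⟩ := ConeN.exists_algEquiv_pointChart K (N := N) a
  have hθG := algEquiv_apply_eq_of_subst K a θ hθa hθj hG _ hcore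
  -- `K[T]/(G) ≅ A[I/y_a]/(g₁) ≅ (A/(f))[Ī/ȳ_a]`
  let η : (MvPolynomial (Fin (N + 1)) K ⧸ Ideal.span {G}) ≃+*
      (blowupAlgebra (Ideal.span (Set.range (X : Fin (N + 1) → MvPolynomial (Fin (N + 1)) K))) (X a) ⧸
        Ideal.span {MvPolynomial.aeval (blowupAlgebra.frac (X : Fin (N + 1) → MvPolynomial (Fin (N + 1)) K) a)
          (MvPolynomial.map (C : K →+* MvPolynomial (Fin (N + 1)) K) Φ) +
          algebraMap (MvPolynomial (Fin (N + 1)) K) (blowupAlgebra (Ideal.span (Set.range (X : Fin (N + 1) → MvPolynomial (Fin (N + 1)) K))) (X a))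
            (X a) * ψ}) :=
    Ideal.quotientEquiv _ _ θ.toRingEquiv (by
      rw [Ideal.map_span, Set.image_singleton]
      exact congrArg (fun b => Ideal.span {b}) hθG.symm)
  have he : ∀ q : MvPolynomial (Fin (N + 1)) K, ε (η (Ideal.Quotient.mk _ q)) =
      blowupAlgebra.mapQuotient (Ideal.span (Set.range (X : Fin (N + 1) → MvPolynomial (Fin (N + 1)) K))) (X a) (Ideal.span {Φ + Ψ}) (θ q) :=
    fun q => by rw [show η (Ideal.Quotient.mk _ q) = Ideal.Quotient.mk _ (θ q) from Ideal.quotientEquiv_mk _ _ _ _ q, hε]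
  -- the exceptional equation under `ε ∘ η`
  have hexc : blowupAlgebra.mapQuotient (Ideal.span (Set.range (X : Fin (N + 1) → MvPolynomial (Fin (N + 1)) K))) (X a)
      (Ideal.span {Φ + Ψ}) (PointBlowup.exc N K a) =
      algebraMap (MvPolynomial (Fin (N + 1)) K ⧸ Ideal.span {Φ + Ψ}) _ (Ideal.Quotient.mk (Ideal.span {Φ + Ψ}) (X a)) :=
    blowupAlgebra.mapQuotient_algebraMap _ _ _ (X a)
  refine ⟨η.trans ε, ?_, ?_⟩
  · rw [RingEquiv.trans_apply, he, hθa, hexc]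
  intro hjac 𝔑 _ h𝔑
  -- the primes of `K[T]/(G)` and of `K[T]` under `𝔑`
  obtain ⟨Pbar, hPbar⟩ : ∃ P : Ideal (MvPolynomial (Fin (N + 1)) K ⧸ Ideal.span {G}), P = 𝔑.comap ((η.trans ε).toRingHom) := ⟨_, rfl⟩
  haveI : Pbar.IsPrime := by rw [hPbar]; exact Ideal.comap_isPrime _ 𝔑
  have hmem : ∀ q, q ∈ Pbar ↔ ε (η q) ∈ 𝔑 := fun q => by rw [hPbar, Ideal.mem_comap]; rfl
  obtain ⟨P, hP⟩ : ∃ P : Ideal (MvPolynomial (Fin (N + 1)) K), P = Pbar.comap (Ideal.Quotient.mk (Ideal.span {G})) := ⟨_, rfl⟩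
  haveI : P.IsPrime := by rw [hP]; exact Ideal.comap_isPrime _ Pbar
  have hmemP : ∀ q, q ∈ P ↔ ε (η (Ideal.Quotient.mk _ q)) ∈ 𝔑 := fun q => by rw [hP, Ideal.mem_comap, hmem]
  have haP : (X a : MvPolynomial (Fin (N + 1)) K) ∈ P := by
    rw [hmemP, he, hθa, hexc]
    exact h𝔑
  have hGP : G ∈ P := by
    rw [hmemP, Ideal.Quotient.eq_zero_iff_mem.mpr (Ideal.mem_span_singleton_self G), map_zero, map_zero]
    exact zero_mem _
  -- Jacobian OR origin, then transport
  rcases hjac P inferInstance haP hGP with ⟨j, hj⟩ | hall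
  · have hj' : Ideal.Quotient.mk (Ideal.span {G}) (pderiv j G) ∉ Pbar := fun h => hj (by rw [hP, Ideal.mem_comap]; exact h)
    have hreg : IsRegularLocalRing (Localization.AtPrime Pbar) :=
      Summit.ResolutionOfSingularities.ResolutionOfSingularities.Theorems.MvPolynomial.isRegularLocalRing_localization_quotient_of_pderiv_notMem Pbar j hj'
    exact Or.inl (OrdPoint.isRegularLocalRing_localization_of_ringEquiv (η.trans ε) Pbar 𝔑 (fun q => (hmem q).symm) hreg)
  · right
    -- `P ⊇ (T)` is the maximal ideal `(T)`, so `Pbar = (T̄)` and `𝔑 = χ(Pbar)`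
    have hTmax : (Ideal.span (Set.range (X : Fin (N + 1) → MvPolynomial (Fin (N + 1)) K))).IsMaximal := by
      have hker : RingHom.ker (constantCoeff : MvPolynomial (Fin (N + 1)) K →+* K) =
          Ideal.span (Set.range (X : Fin (N + 1) → MvPolynomial (Fin (N + 1)) K)) := by
        ext q
        change q ∈ RingHom.ker _ ↔ q ∈ MvPolynomial.idealOfVars (Fin (N + 1)) K
        rw [RingHom.mem_ker, ← pow_one (MvPolynomial.idealOfVars (Fin (N + 1)) K), MvPolynomial.mem_pow_idealOfVars_iff']
        constructor
        · intro h x hx'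
          rw [Nat.lt_one_iff, Finsupp.degree_eq_zero_iff] at hx'
          subst hx'
          exact h
        · intro h
          exact h 0 (by simp)
      rw [← hker]
      exact RingHom.ker_isMaximal_of_surjective _ fun c => ⟨C c, constantCoeff_C _ c⟩
    have hPT : P = Ideal.span (Set.range (X : Fin (N + 1) → MvPolynomial (Fin (N + 1)) K)) :=
      (hTmax.eq_of_le (Ideal.IsPrime.ne_top inferInstance) (Ideal.span_le.mpr (Set.range_subset_iff.mpr hall))).symm
    have hPbar' : Ideal.map (Ideal.Quotient.mk (Ideal.span {G})) P = Pbar := by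
      rw [hP]; exact Ideal.map_comap_of_surjective _ Ideal.Quotient.mk_surjective Pbar
    have h𝔑' : Ideal.map (η.trans ε).toRingHom Pbar = 𝔑 := by
      rw [hPbar]; exact Ideal.map_comap_of_surjective _ (η.trans ε).surjective 𝔑
    rw [← h𝔑', ← hPbar', hPT]

end OneStep

end Summit.ResolutionOfSingularities.ResolutionOfSingularities.Cruxes.EquisingularLiftNat.Sections

end
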